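import Summits.NavierStokesRegularity.NavierStokesRegularity.Theorems.EulerZoomLiouvillePowerGaugeEulerLiouvilleBreatherWeakRigidityLarge
import Summits.NavierStokesRegularity.NavierStokesRegularity.Theorems.EulerZoomLiouvillePowerGaugeEulerLiouvillePressureSlavingBreatherProfile
import Summits.NavierStokesRegularity.NavierStokesRegularity.Theorems.EulerZoomLiouvillePowerGaugeEulerLiouvillePastFastClock
import Summits.NavierStokesRegularity.NavierStokesRegularity.Theorems.EulerZoomLiouvillePowerGaugeEulerLiouvillePastSymmetric
import Literature.Analysis.FluidPDE.LocalEnergyTimeShift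

/-!
# Crux `EulerZoomLiouville.PowerGaugeEulerLiouville` (stmt-NavierStokesRegularity-19832), line `logtime-breathers`:
# WEAK BREATHER RIGIDITY, PAST FORM — a member that is a log-time breather on a past sub-slab `τ < T₁` is trivial

Width seat `ns-ezl-w4` (g3; file L4, the past member).  Crux hypotheses (`0 < ρ ≤ ½`) and `u(τ, y) = e^{cτ} V(e^{−cτ} y)` for `τ < T₁` only
(`T₁ ≤ 0`; nothing assumed on `[T₁, 0)`), `c ≠ 0`, ANY profile ⇒ `u = 0` a.e. on the slab (`BreatherWeak.ae_eq_zero_of_gauge_of_pastBreather`).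
`c < 0`: the tree's `PastShape.ae_eq_zero_of_gauge_of_pastExpandingBreather`.  `c > 0` (`…_pastContractingBreather`): TRANSLATE TIME by `T₁` —
`ũ(s) = u(T₁ + s)` is a whole-slab breather, suitable weak with weak gradient (`IsSuitableWeakSolutionOn.stRescale`, `HasWeakSpatialGradientOn.stRescale`),
keeping the three gauges at LARGE scales `a ≥ 1` with constant `(1 − T₁)c₀` (`Q_a(0,0) + (T₁,0) ⊆ Q_{a'}(0,0)`, `a'² = a² − T₁`; `cknA/E/D_timeShift_le`);
breather pressure slaving on `ũ` (`PressureSlaving.breather_pressure_ae_invariant`, thresholded `D`-bound) + `PressureSwap` give an exact breather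
pressure in the same large-scale class, `BreatherWeak.profile_ae_eq_zero_of_largeGauge_of_contractingBreather_pressure` empties the profile, every slice
`u(τ)`, `τ < T₁`, vanishes a.e., and `PastSymmetric.ae_eq_zero_of_gauge_of_pastSlicesZero` closes the slab.  So `IsTameBreather` needs NO clause:
`∃ T₁ c V, T₁ ≤ 0 ∧ c ≠ 0 ∧ ∀ τ < T₁, ∀ y, u τ y = e^{cτ} • V (e^{−cτ} • y)` is trivial.
WHAT THIS IS NOT: not NS regularity, not E — a named WEAK stratum of the crux CLASS 19832 (MODEL lattice); 19832 OPEN; `--supports` stmt-19832. [folklore]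
-/

noncomputable section

set_option linter.dupNamespace false

open MeasureTheory Set Filter Topology Metric Function TopologicalSpace
open scoped ENNReal NNReal RealInnerProductSpace ContDiff

namespace Summit.NavierStokesRegularity.NavierStokesRegularity.Theorems.PowerGaugeEulerLiouville

open Literature.Analysis Literature.Analysis.FunctionSpaces Literature.Analysis.FluidPDE

namespace BreatherWeak

variable {u : ℝ → EuclideanSpace ℝ (Fin 3) → EuclideanSpace ℝ (Fin 3)} {p : ℝ → EuclideanSpace ℝ (Fin 3) → ℝ}
  {H : ℝ → EuclideanSpace ℝ (Fin 3) → EuclideanSpace ℝ (Fin 3) →L[ℝ] EuclideanSpace ℝ (Fin 3)}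

/-! ### Time translation of a class member -/

/-- The slab `(−∞,0) × ℝ³` lies in its preimage under the time translation by `T₁ ≤ 0`. [folklore] -/
theorem slab_le_stPreimage_timeShift {T₁ : ℝ} (hT₁ : T₁ ≤ 0) :
    (slab (EuclideanSpace ℝ (Fin 3)) (Iio 0) isOpen_Iio) ≤
      stPreimage 1 1 T₁ (0 : EuclideanSpace ℝ (Fin 3)) (slab (EuclideanSpace ℝ (Fin 3)) (Iio 0) isOpen_Iio) := by
  intro z hz
  have hz' : z.1 < 0 := mem_Iio.1 (mem_slab.1 hz)
  show z ∈ ((stPreimage 1 1 T₁ (0 : EuclideanSpace ℝ (Fin 3)) (slab (EuclideanSpace ℝ (Fin 3)) (Iio 0) isOpen_Iio) :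
    Opens (ℝ × EuclideanSpace ℝ (Fin 3))) : Set (ℝ × EuclideanSpace ℝ (Fin 3)))
  rw [coe_stPreimage, mem_preimage, SetLike.mem_coe, mem_slab, stAffine_fst, one_mul, mem_Iio]
  linarith

/-- Time translation by `T₁ ≤ 0` of a suitable weak Euler pair on the slab is suitable weak on the slab. [folklore] -/
theorem isSuitableWeakSolutionOn_timeShift
    (hsw : IsSuitableWeakSolutionOn (slab (EuclideanSpace ℝ (Fin 3)) (Iio 0) isOpen_Iio) 0 0 u p) {T₁ : ℝ} (hT₁ : T₁ ≤ 0) :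
    IsSuitableWeakSolutionOn (slab (EuclideanSpace ℝ (Fin 3)) (Iio 0) isOpen_Iio) 0 0
      (fun s y => u (T₁ + s) y) (fun s y => p (T₁ + s) y) := by
  have h1 := hsw.stRescale one_pos one_pos (show (1 : ℝ) = 1 * 1 by norm_num) T₁ (0 : EuclideanSpace ℝ (Fin 3))
  rw [one_smul_stPull_one_one, one_sq_smul_stPull] at h1
  have hν : (1 : ℝ) * 0 / 1 = 0 := by norm_num
  have hf : (((1 : ℝ) ^ 2 * 1) • stPull 1 1 T₁ (0 : EuclideanSpace ℝ (Fin 3))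
      (0 : ℝ → EuclideanSpace ℝ (Fin 3) → EuclideanSpace ℝ (Fin 3))) = 0 := by
    funext s y; simp [smul_stPull_apply]
  rw [hν, hf] at h1
  exact h1.of_le (slab_le_stPreimage_timeShift hT₁)

/-- **Time translation of a weak spatial gradient on the slab** (`T₁ ≤ 0`). [folklore] -/
theorem hasWeakSpatialGradientOn_timeShift
    (hH : HasWeakSpatialGradientOn (slab (EuclideanSpace ℝ (Fin 3)) (Iio 0) isOpen_Iio) u H) {T₁ : ℝ} (hT₁ : T₁ ≤ 0) :
    HasWeakSpatialGradientOn (slab (EuclideanSpace ℝ (Fin 3)) (Iio 0) isOpen_Iio)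
      (fun s y => u (T₁ + s) y) (fun s y => H (T₁ + s) y) := by
  have h1 := hH.stRescale 1 one_pos one_pos T₁ (0 : EuclideanSpace ℝ (Fin 3))
  rw [one_smul_stPull_one_one] at h1
  have e : (((1 : ℝ) * 1) • stPull 1 1 T₁ (0 : EuclideanSpace ℝ (Fin 3)) H) = fun s y => H (T₁ + s) y := by
    funext s y; simp only [Pi.smul_apply, stPull_apply, one_mul, one_smul, zero_add]
  rw [e] at h1
  exact h1.mono (slab_le_stPreimage_timeShift hT₁)

/-! ### The three gauges of the translated member at LARGE scales -/

/-- `(ofReal a)⁻¹ = ofReal (a'/a) * (ofReal a')⁻¹` for `a, a' > 0`. [folklore] -/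
theorem ofReal_inv_eq_mul {a a' : ℝ} (ha : 0 < a) (ha' : 0 < a') :
    (ENNReal.ofReal a)⁻¹ = ENNReal.ofReal (a' / a) * (ENNReal.ofReal a')⁻¹ := by
  have h0 : ENNReal.ofReal a' ≠ 0 := by rwa [Ne, ENNReal.ofReal_eq_zero, not_le]
  rw [ENNReal.ofReal_div_of_pos ha, div_eq_mul_inv, mul_comm (ENNReal.ofReal a') _, mul_assoc,
    ENNReal.mul_inv_cancel h0 ENNReal.ofReal_ne_top, mul_one]

/-- **`A`-gauge of the translated member**: `A(a; ũ) ≤ (a'/a) A(a'; u)`, `a' = √(a² − T₁)` (`T₁ ≤ 0`): every slice `t ∈ (−a², 0)` of `ũ = u(T₁+·)` is the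
slice `T₁ + t ∈ (−a'², 0)` of `u`, and `B_a ⊆ B_{a'}`. [folklore] -/
theorem cknA_timeShift_le {T₁ : ℝ} (hT₁ : T₁ ≤ 0) {a : ℝ} (ha : 0 < a) :
    cknA a (0 : ℝ × EuclideanSpace ℝ (Fin 3)) (fun s y => u (T₁ + s) y) ≤
      ENNReal.ofReal (Real.sqrt (a ^ 2 - T₁) / a) * cknA (Real.sqrt (a ^ 2 - T₁)) (0 : ℝ × EuclideanSpace ℝ (Fin 3)) u := by
  set a' : ℝ := Real.sqrt (a ^ 2 - T₁) with ha'def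
  have hsq : a' ^ 2 = a ^ 2 - T₁ := by rw [ha'def, Real.sq_sqrt (by nlinarith)]
  have haa' : a ≤ a' := by
    calc a = Real.sqrt (a ^ 2) := (Real.sqrt_sq ha.le).symm
      _ ≤ a' := by rw [ha'def]; exact Real.sqrt_le_sqrt (by linarith)
  have ha'0 : 0 < a' := lt_of_lt_of_le ha haa'
  unfold cknA
  refine iSup₂_le fun t ht => ?_
  simp only [Prod.fst_zero, zero_sub, mem_Ioo] at ht
  have ht' : T₁ + t ∈ Ioo ((0 : ℝ × EuclideanSpace ℝ (Fin 3)).1 - a' ^ 2) (0 : ℝ × EuclideanSpace ℝ (Fin 3)).1 := by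
    simp only [Prod.fst_zero, zero_sub, mem_Ioo]
    constructor <;> nlinarith [ht.1, ht.2]
  have hle : ∫⁻ x in ball (0 : EuclideanSpace ℝ (Fin 3)) a, ‖u (T₁ + t) x‖ₑ ^ 2 ≤
      ∫⁻ x in ball (0 : EuclideanSpace ℝ (Fin 3)) a', ‖u (T₁ + t) x‖ₑ ^ 2 :=
    lintegral_mono_set (ball_subset_ball haa')
  have hup : (ENNReal.ofReal a')⁻¹ * ∫⁻ x in ball (0 : EuclideanSpace ℝ (Fin 3)) a', ‖u (T₁ + t) x‖ₑ ^ 2 ≤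
      cknA a' (0 : ℝ × EuclideanSpace ℝ (Fin 3)) u := by
    unfold cknA
    exact le_iSup₂ (f := fun s (_ : s ∈ Ioo ((0 : ℝ × EuclideanSpace ℝ (Fin 3)).1 - a' ^ 2)
        (0 : ℝ × EuclideanSpace ℝ (Fin 3)).1) =>
        (ENNReal.ofReal a')⁻¹ * ∫⁻ x in ball (0 : ℝ × EuclideanSpace ℝ (Fin 3)).2 a', ‖u s x‖ₑ ^ 2) (T₁ + t) ht'
  calc (ENNReal.ofReal a)⁻¹ * ∫⁻ x in ball (0 : ℝ × EuclideanSpace ℝ (Fin 3)).2 a, ‖u (T₁ + t) x‖ₑ ^ 2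
      ≤ (ENNReal.ofReal a)⁻¹ * ∫⁻ x in ball (0 : EuclideanSpace ℝ (Fin 3)) a', ‖u (T₁ + t) x‖ₑ ^ 2 := mul_le_mul' le_rfl hle
    _ = ENNReal.ofReal (a' / a) * ((ENNReal.ofReal a')⁻¹ * ∫⁻ x in ball (0 : EuclideanSpace ℝ (Fin 3)) a', ‖u (T₁ + t) x‖ₑ ^ 2) := by
        rw [← mul_assoc, ← ofReal_inv_eq_mul ha ha'0]
    _ ≤ ENNReal.ofReal (a' / a) * cknA a' (0 : ℝ × EuclideanSpace ℝ (Fin 3)) u := mul_le_mul' le_rfl hup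

/-- The translated cylinder: `∫∫_{Q_a(0,0)} F(T₁ + t, x) ≤ ∫∫_{Q_{a'}(0,0)} F`, `a' = √(a² − T₁)`, `T₁ ≤ 0`. [folklore] -/
theorem lintegral_cylinder_timeShift_le {T₁ : ℝ} (hT₁ : T₁ ≤ 0) {a : ℝ} (ha : 0 < a)
    (F : ℝ × EuclideanSpace ℝ (Fin 3) → ℝ≥0∞) :
    ∫⁻ q in parabolicCylinder a (0 : ℝ × EuclideanSpace ℝ (Fin 3)), F (T₁ + q.1, q.2) ≤
      ∫⁻ q in parabolicCylinder (Real.sqrt (a ^ 2 - T₁)) (0 : ℝ × EuclideanSpace ℝ (Fin 3)), F q := by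
  set a' : ℝ := Real.sqrt (a ^ 2 - T₁) with ha'def
  have hsq : a' ^ 2 = a ^ 2 - T₁ := by rw [ha'def, Real.sq_sqrt (by nlinarith)]
  have haa' : a ≤ a' := by
    calc a = Real.sqrt (a ^ 2) := (Real.sqrt_sq ha.le).symm
      _ ≤ a' := by rw [ha'def]; exact Real.sqrt_le_sqrt (by linarith)
  have hQ : parabolicCylinder a (0 : ℝ × EuclideanSpace ℝ (Fin 3)) =
      Ioo ((T₁ - a ^ 2) - T₁) (T₁ - T₁) ×ˢ ball (0 : EuclideanSpace ℝ (Fin 3)) a := by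
    rw [parabolicCylinder, Prod.fst_zero, Prod.snd_zero]; congr 1; congr 1 <;> ring
  rw [hQ, setLIntegral_prod_timeShift T₁ (T₁ - a ^ 2) T₁ (ball (0 : EuclideanSpace ℝ (Fin 3)) a) F]
  refine lintegral_mono_set ?_
  intro q hq
  rw [mem_prod, mem_Ioo, mem_ball] at hq
  rw [mem_parabolicCylinder, Prod.fst_zero, Prod.snd_zero, zero_sub]
  refine ⟨⟨by nlinarith [hq.1.1], by linarith [hq.1.2]⟩, lt_of_lt_of_le hq.2 haa'⟩

/-- **`E`-gauge of the translated member**: `E(a; H̃) ≤ (a'/a) E(a'; H)`. [folklore] -/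
theorem cknE_timeShift_le {T₁ : ℝ} (hT₁ : T₁ ≤ 0) {a : ℝ} (ha : 0 < a) :
    cknE a (0 : ℝ × EuclideanSpace ℝ (Fin 3)) (fun s y => H (T₁ + s) y) ≤
      ENNReal.ofReal (Real.sqrt (a ^ 2 - T₁) / a) *
        cknE (Real.sqrt (a ^ 2 - T₁)) (0 : ℝ × EuclideanSpace ℝ (Fin 3)) H := by
  have ha'0 : 0 < Real.sqrt (a ^ 2 - T₁) := Real.sqrt_pos.2 (by nlinarith)
  unfold cknE
  have h := lintegral_cylinder_timeShift_le hT₁ ha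
    (fun q : ℝ × EuclideanSpace ℝ (Fin 3) => ENNReal.ofReal (frobeniusNormSq (H q.1 q.2)))
  calc (ENNReal.ofReal a)⁻¹ * ∫⁻ q in parabolicCylinder a (0 : ℝ × EuclideanSpace ℝ (Fin 3)),
        ENNReal.ofReal (frobeniusNormSq (H (T₁ + q.1) q.2))
      ≤ (ENNReal.ofReal a)⁻¹ * ∫⁻ q in parabolicCylinder (Real.sqrt (a ^ 2 - T₁)) (0 : ℝ × EuclideanSpace ℝ (Fin 3)),
          ENNReal.ofReal (frobeniusNormSq (H q.1 q.2)) := mul_le_mul' le_rfl h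
    _ = _ := by rw [ofReal_inv_eq_mul ha ha'0, mul_assoc]

/-- **`D`-gauge of the translated member**: `D(a; p̃) ≤ (a'/a)² D(a'; p)`. [folklore] -/
theorem cknD_timeShift_le {T₁ : ℝ} (hT₁ : T₁ ≤ 0) {a : ℝ} (ha : 0 < a) :
    cknD a (0 : ℝ × EuclideanSpace ℝ (Fin 3)) (fun s y => p (T₁ + s) y) ≤
      ENNReal.ofReal ((Real.sqrt (a ^ 2 - T₁) / a) ^ 2) *
        cknD (Real.sqrt (a ^ 2 - T₁)) (0 : ℝ × EuclideanSpace ℝ (Fin 3)) p := by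
  set a' : ℝ := Real.sqrt (a ^ 2 - T₁) with ha'def
  have ha'0 : 0 < a' := Real.sqrt_pos.2 (by nlinarith)
  unfold cknD
  have h := lintegral_cylinder_timeShift_le hT₁ ha
    (fun q : ℝ × EuclideanSpace ℝ (Fin 3) => ‖p q.1 q.2‖ₑ ^ (3 / 2 : ℝ))
  have hinv : (ENNReal.ofReal a ^ 2)⁻¹ = ENNReal.ofReal ((a' / a) ^ 2) * (ENNReal.ofReal a' ^ 2)⁻¹ := by
    rw [ENNReal.ofReal_pow (by positivity), ENNReal.inv_pow, ENNReal.inv_pow, ← mul_pow,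
      ← ofReal_inv_eq_mul ha ha'0]
  calc (ENNReal.ofReal a ^ 2)⁻¹ * ∫⁻ q in parabolicCylinder a (0 : ℝ × EuclideanSpace ℝ (Fin 3)), ‖p (T₁ + q.1) q.2‖ₑ ^ (3 / 2 : ℝ)
      ≤ (ENNReal.ofReal a ^ 2)⁻¹ * ∫⁻ q in parabolicCylinder a' (0 : ℝ × EuclideanSpace ℝ (Fin 3)), ‖p q.1 q.2‖ₑ ^ (3 / 2 : ℝ) :=
        mul_le_mul' le_rfl h
    _ = _ := by rw [hinv, mul_assoc]

/-- **The translated member keeps the three gauges at LARGE scales**: if `a^{2ρ}A + a^{ρ}E + a^{2ρ}D ≤ c₀` for all `a > 0` (`ρ ≥ 0`), then for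
`ũ = u(T₁+·)`, `p̃`, `H̃` (`T₁ ≤ 0`) the same sum at every `a ≥ 1` is `≤ (1 − T₁) c₀`. [folklore] -/
theorem gauge_timeShift_le_of_large {ρ : ℝ} (hρ : 0 ≤ ρ) {c₀ : ℝ≥0}
    (hgauge : ∀ a : ℝ, 0 < a →
      ENNReal.ofReal (a ^ (2 * ρ)) * cknA a (0 : ℝ × EuclideanSpace ℝ (Fin 3)) u +
          ENNReal.ofReal (a ^ ρ) * cknE a (0 : ℝ × EuclideanSpace ℝ (Fin 3)) H +
        ENNReal.ofReal (a ^ (2 * ρ)) * cknD a (0 : ℝ × EuclideanSpace ℝ (Fin 3)) p ≤ (c₀ : ℝ≥0∞))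
    {T₁ : ℝ} (hT₁ : T₁ ≤ 0) {a : ℝ} (ha : 1 ≤ a) :
    ENNReal.ofReal (a ^ (2 * ρ)) * cknA a (0 : ℝ × EuclideanSpace ℝ (Fin 3)) (fun s y => u (T₁ + s) y) +
          ENNReal.ofReal (a ^ ρ) * cknE a (0 : ℝ × EuclideanSpace ℝ (Fin 3)) (fun s y => H (T₁ + s) y) +
        ENNReal.ofReal (a ^ (2 * ρ)) * cknD a (0 : ℝ × EuclideanSpace ℝ (Fin 3)) (fun s y => p (T₁ + s) y) ≤
      ENNReal.ofReal (1 - T₁) * (c₀ : ℝ≥0∞) := by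
  have ha0 : 0 < a := lt_of_lt_of_le one_pos ha
  set a' : ℝ := Real.sqrt (a ^ 2 - T₁) with ha'def
  have hsq : a' ^ 2 = a ^ 2 - T₁ := by rw [ha'def, Real.sq_sqrt (by nlinarith)]
  have haa' : a ≤ a' := by
    calc a = Real.sqrt (a ^ 2) := (Real.sqrt_sq ha0.le).symm
      _ ≤ a' := by rw [ha'def]; exact Real.sqrt_le_sqrt (by linarith)
  have ha'0 : 0 < a' := lt_of_lt_of_le ha0 haa'
  -- the ratio `r = a'/a ∈ [1, 1 − T₁]`, hence `r ≤ r² ≤ 1 − T₁`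
  set r : ℝ := a' / a with hr
  have hr1 : 1 ≤ r := by rw [hr, le_div_iff₀ ha0, one_mul]; exact haa'
  have hr2 : r ^ 2 ≤ 1 - T₁ := by
    rw [hr, div_pow, hsq, div_le_iff₀ (by positivity)]
    nlinarith [mul_nonneg (neg_nonneg.2 hT₁) (by nlinarith : (0 : ℝ) ≤ a ^ 2 - 1)]
  have hrM : r ≤ 1 - T₁ := le_trans (by nlinarith) hr2
  -- powers: `a^θ ≤ a'^θ`
  have hp2 : a ^ (2 * ρ) ≤ a' ^ (2 * ρ) := Real.rpow_le_rpow ha0.le haa' (by linarith)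
  have hp1 : a ^ ρ ≤ a' ^ ρ := Real.rpow_le_rpow ha0.le haa' hρ
  -- the three terms
  have hA := cknA_timeShift_le (u := u) hT₁ ha0
  have hE := cknE_timeShift_le (H := H) hT₁ ha0
  have hD := cknD_timeShift_le (p := p) hT₁ ha0
  have hM : ENNReal.ofReal r ≤ ENNReal.ofReal (1 - T₁) := ENNReal.ofReal_le_ofReal hrM
  have hM2 : ENNReal.ofReal (r ^ 2) ≤ ENNReal.ofReal (1 - T₁) := ENNReal.ofReal_le_ofReal hr2
  have h1 : ENNReal.ofReal (a ^ (2 * ρ)) * cknA a (0 : ℝ × EuclideanSpace ℝ (Fin 3)) (fun s y => u (T₁ + s) y) ≤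
      ENNReal.ofReal (1 - T₁) * (ENNReal.ofReal (a' ^ (2 * ρ)) * cknA a' (0 : ℝ × EuclideanSpace ℝ (Fin 3)) u) :=
    calc _ ≤ ENNReal.ofReal (a' ^ (2 * ρ)) * (ENNReal.ofReal r * cknA a' (0 : ℝ × EuclideanSpace ℝ (Fin 3)) u) :=
          mul_le_mul' (ENNReal.ofReal_le_ofReal hp2) hA
      _ = ENNReal.ofReal r * (ENNReal.ofReal (a' ^ (2 * ρ)) * cknA a' (0 : ℝ × EuclideanSpace ℝ (Fin 3)) u) := by ring
      _ ≤ _ := mul_le_mul' hM le_rfl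
  have h2 : ENNReal.ofReal (a ^ ρ) * cknE a (0 : ℝ × EuclideanSpace ℝ (Fin 3)) (fun s y => H (T₁ + s) y) ≤
      ENNReal.ofReal (1 - T₁) * (ENNReal.ofReal (a' ^ ρ) * cknE a' (0 : ℝ × EuclideanSpace ℝ (Fin 3)) H) :=
    calc _ ≤ ENNReal.ofReal (a' ^ ρ) * (ENNReal.ofReal r * cknE a' (0 : ℝ × EuclideanSpace ℝ (Fin 3)) H) :=
          mul_le_mul' (ENNReal.ofReal_le_ofReal hp1) hE
      _ = ENNReal.ofReal r * (ENNReal.ofReal (a' ^ ρ) * cknE a' (0 : ℝ × EuclideanSpace ℝ (Fin 3)) H) := by ring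
      _ ≤ _ := mul_le_mul' hM le_rfl
  have h3 : ENNReal.ofReal (a ^ (2 * ρ)) * cknD a (0 : ℝ × EuclideanSpace ℝ (Fin 3)) (fun s y => p (T₁ + s) y) ≤
      ENNReal.ofReal (1 - T₁) * (ENNReal.ofReal (a' ^ (2 * ρ)) * cknD a' (0 : ℝ × EuclideanSpace ℝ (Fin 3)) p) :=
    calc _ ≤ ENNReal.ofReal (a' ^ (2 * ρ)) * (ENNReal.ofReal (r ^ 2) * cknD a' (0 : ℝ × EuclideanSpace ℝ (Fin 3)) p) :=
          mul_le_mul' (ENNReal.ofReal_le_ofReal hp2) hD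
      _ = ENNReal.ofReal (r ^ 2) * (ENNReal.ofReal (a' ^ (2 * ρ)) * cknD a' (0 : ℝ × EuclideanSpace ℝ (Fin 3)) p) := by ring
      _ ≤ _ := mul_le_mul' hM2 le_rfl
  calc _ ≤ ENNReal.ofReal (1 - T₁) * (ENNReal.ofReal (a' ^ (2 * ρ)) * cknA a' (0 : ℝ × EuclideanSpace ℝ (Fin 3)) u) +
        ENNReal.ofReal (1 - T₁) * (ENNReal.ofReal (a' ^ ρ) * cknE a' (0 : ℝ × EuclideanSpace ℝ (Fin 3)) H) +
        ENNReal.ofReal (1 - T₁) * (ENNReal.ofReal (a' ^ (2 * ρ)) * cknD a' (0 : ℝ × EuclideanSpace ℝ (Fin 3)) p) :=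
        add_le_add (add_le_add h1 h2) h3
    _ = ENNReal.ofReal (1 - T₁) * (ENNReal.ofReal (a' ^ (2 * ρ)) * cknA a' (0 : ℝ × EuclideanSpace ℝ (Fin 3)) u +
        ENNReal.ofReal (a' ^ ρ) * cknE a' (0 : ℝ × EuclideanSpace ℝ (Fin 3)) H +
        ENNReal.ofReal (a' ^ (2 * ρ)) * cknD a' (0 : ℝ × EuclideanSpace ℝ (Fin 3)) p) := by ring
    _ ≤ ENNReal.ofReal (1 - T₁) * (c₀ : ℝ≥0∞) := mul_le_mul' le_rfl (hgauge a' ha'0)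

/-! ### From a `D`-gauge bound at one scale to the cylinder integral -/

/-- `a^{2ρ} D(a; p) ≤ K` ⇒ `∫∫_{Q_a} |p|^{3/2} ≤ K a^{2−2ρ}` (one scale `a > 0`; the tree's `lintegral_cylinder_le_of_gaugeD` pointwise in `a`). [folklore] -/
theorem lintegral_cylinder_le_of_gaugeD_at {ρ : ℝ} {K : ℝ≥0∞} {a : ℝ} (ha : 0 < a)
    (h : ENNReal.ofReal (a ^ (2 * ρ)) * cknD a (0 : ℝ × EuclideanSpace ℝ (Fin 3)) p ≤ K) :
    ∫⁻ z in parabolicCylinder a (0 : ℝ × EuclideanSpace ℝ (Fin 3)), ‖p z.1 z.2‖ₑ ^ (3 / 2 : ℝ) ≤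
      K * ENNReal.ofReal (a ^ (2 - 2 * ρ)) := by
  set I := ∫⁻ z in parabolicCylinder a (0 : ℝ × EuclideanSpace ℝ (Fin 3)), ‖p z.1 z.2‖ₑ ^ (3 / 2 : ℝ) with hI
  unfold cknD at h
  have h2 : ENNReal.ofReal a ^ 2 ≠ 0 := pow_ne_zero _ (by rwa [Ne, ENNReal.ofReal_eq_zero, not_le])
  have h2t : ENNReal.ofReal a ^ 2 ≠ ⊤ := ENNReal.pow_ne_top ENNReal.ofReal_ne_top
  have hρ0 : ENNReal.ofReal (a ^ (2 * ρ)) ≠ 0 := by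
    rw [Ne, ENNReal.ofReal_eq_zero, not_le]; exact Real.rpow_pos_of_pos ha _
  have hρt : ENNReal.ofReal (a ^ (2 * ρ)) ≠ ⊤ := ENNReal.ofReal_ne_top
  have hX : (ENNReal.ofReal a ^ 2)⁻¹ * I ≤ K / ENNReal.ofReal (a ^ (2 * ρ)) := by
    rw [ENNReal.le_div_iff_mul_le (Or.inl hρ0) (Or.inl hρt), mul_comm]
    exact h
  calc I = ENNReal.ofReal a ^ 2 * ((ENNReal.ofReal a ^ 2)⁻¹ * I) := by
        rw [← mul_assoc, ENNReal.mul_inv_cancel h2 h2t, one_mul]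
    _ ≤ ENNReal.ofReal a ^ 2 * (K / ENNReal.ofReal (a ^ (2 * ρ))) := by gcongr
    _ = K * (ENNReal.ofReal (a ^ 2) / ENNReal.ofReal (a ^ (2 * ρ))) := by
        rw [ENNReal.ofReal_pow ha.le]
        rw [ENNReal.div_eq_inv_mul, ENNReal.div_eq_inv_mul]
        ring
    _ = K * ENNReal.ofReal (a ^ (2 - 2 * ρ)) := by
        rw [← ENNReal.ofReal_div_of_pos (Real.rpow_pos_of_pos ha _), show a ^ 2 = a ^ (2 : ℝ) by norm_cast,
          ← Real.rpow_sub ha]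

/-! ### The past member -/

/-- **WEAK CONTRACTING BREATHERS ON A PAST SUB-SLAB ARE TRIVIAL.**  Crux hypotheses (`0 < ρ ≤ ½`) and `u(τ, y) = e^{cτ} V(e^{−cτ} y)` for all
`τ < T₁` (`T₁ ≤ 0`), `c > 0`, any profile ⇒ `u = 0` a.e. on the slab (time translation by `T₁` + the large-scale engine
`profile_ae_eq_zero_of_largeGauge_of_contractingBreather_pressure` + breather pressure slaving + the energy-quiescent past). [folklore] -/
theorem ae_eq_zero_of_gauge_of_pastContractingBreather {ρ : ℝ} (hρ : 0 < ρ) (hρh : ρ ≤ 1 / 2) {c₀ : ℝ≥0}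
    (hsw : IsSuitableWeakSolutionOn (slab (EuclideanSpace ℝ (Fin 3)) (Iio 0) isOpen_Iio) 0 0 u p)
    (hH : HasWeakSpatialGradientOn (slab (EuclideanSpace ℝ (Fin 3)) (Iio 0) isOpen_Iio) u H)
    (hgauge : ∀ a : ℝ, 0 < a →
      ENNReal.ofReal (a ^ (2 * ρ)) * cknA a (0 : ℝ × EuclideanSpace ℝ (Fin 3)) u +
          ENNReal.ofReal (a ^ ρ) * cknE a (0 : ℝ × EuclideanSpace ℝ (Fin 3)) H +
        ENNReal.ofReal (a ^ (2 * ρ)) * cknD a (0 : ℝ × EuclideanSpace ℝ (Fin 3)) p ≤ (c₀ : ℝ≥0∞))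
    {T₁ : ℝ} (hT₁ : T₁ ≤ 0) {c : ℝ} (hc : 0 < c) {V : EuclideanSpace ℝ (Fin 3) → EuclideanSpace ℝ (Fin 3)}
    (hbr : ∀ τ : ℝ, τ < T₁ → ∀ y, u τ y = Real.exp (c * τ) • V (Real.exp (-(c * τ)) • y)) :
    uncurry u =ᵐ[volume.restrict (Iio (0 : ℝ) ×ˢ (univ : Set (EuclideanSpace ℝ (Fin 3))))] 0 := by
  have hρ1 : ρ < 1 := by linarith
  -- ### the translated member
  set ut : ℝ → EuclideanSpace ℝ (Fin 3) → EuclideanSpace ℝ (Fin 3) := fun s y => u (T₁ + s) y with hut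
  set pt : ℝ → EuclideanSpace ℝ (Fin 3) → ℝ := fun s y => p (T₁ + s) y with hpt
  set Ht : ℝ → EuclideanSpace ℝ (Fin 3) → EuclideanSpace ℝ (Fin 3) →L[ℝ] EuclideanSpace ℝ (Fin 3) :=
    fun s y => H (T₁ + s) y with hHt
  have hswt : IsSuitableWeakSolutionOn (slab (EuclideanSpace ℝ (Fin 3)) (Iio 0) isOpen_Iio) 0 0 ut pt :=
    isSuitableWeakSolutionOn_timeShift hsw hT₁
  have hHt' : HasWeakSpatialGradientOn (slab (EuclideanSpace ℝ (Fin 3)) (Iio 0) isOpen_Iio) ut Ht :=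
    hasWeakSpatialGradientOn_timeShift hH hT₁
  set c₁ : ℝ≥0 := (1 - T₁).toNNReal * c₀ with hc₁
  have hc₁e : (c₁ : ℝ≥0∞) = ENNReal.ofReal (1 - T₁) * (c₀ : ℝ≥0∞) := by
    simp only [hc₁, ENNReal.coe_mul, ENNReal.ofReal]
  have hgauget : ∀ a : ℝ, 1 ≤ a →
      ENNReal.ofReal (a ^ (2 * ρ)) * cknA a (0 : ℝ × EuclideanSpace ℝ (Fin 3)) ut +
          ENNReal.ofReal (a ^ ρ) * cknE a (0 : ℝ × EuclideanSpace ℝ (Fin 3)) Ht +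
        ENNReal.ofReal (a ^ (2 * ρ)) * cknD a (0 : ℝ × EuclideanSpace ℝ (Fin 3)) pt ≤ (c₁ : ℝ≥0∞) := by
    intro a ha
    rw [hc₁e]
    exact gauge_timeShift_le_of_large hρ.le hgauge hT₁ ha
  -- the translated member is a whole-slab breather with profile `Vt = e^{cT₁} V(e^{-cT₁}·)`
  set Vt : EuclideanSpace ℝ (Fin 3) → EuclideanSpace ℝ (Fin 3) :=
    fun z => Real.exp (c * T₁) • V (Real.exp (-(c * T₁)) • z) with hVt
  have hbrt : ∀ s : ℝ, s < 0 → ∀ y, ut s y = Real.exp (c * s) • Vt (Real.exp (-(c * s)) • y) := by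
    intro s hs y
    have hsT : T₁ + s < T₁ := by linarith
    show u (T₁ + s) y = _
    rw [hbr (T₁ + s) hsT y]
    simp only [hVt, smul_smul, ← Real.exp_add]
    ring_nf
  -- ### breather pressure slaving on the translated member (large-scale `D`-bound only)
  have hptm : AEStronglyMeasurable (uncurry pt)
      (volume.restrict (Iio (0 : ℝ) ×ˢ (univ : Set (EuclideanSpace ℝ (Fin 3))))) := by
    have h := hswt.distributional.2.2.1.aestronglyMeasurable; rwa [coe_slab] at h
  have hDt : ∀ a : ℝ, 1 ≤ a →
      ∫⁻ z in parabolicCylinder a (0 : ℝ × EuclideanSpace ℝ (Fin 3)), ‖pt z.1 z.2‖ₑ ^ (3 / 2 : ℝ) ≤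
        (c₁ : ℝ≥0∞) * ENNReal.ofReal (a ^ (2 - 2 * ρ)) := by
    intro a ha
    exact lintegral_cylinder_le_of_gaugeD_at (lt_of_lt_of_le one_pos ha) (le_trans le_add_self (hgauget a ha))
  have hinv : ∀ h : ℝ, h ≤ 0 → ∀ᵐ z ∂(volume.restrict (Iio (0 : ℝ) ×ˢ (univ : Set (EuclideanSpace ℝ (Fin 3))))),
      pt z.1 z.2 = Real.exp (-(c * h)) ^ 2 * pt (z.1 + h) (Real.exp (c * h) • z.2) := fun h hh =>
    PressureSlaving.breather_pressure_ae_invariant hh hswt.distributional ENNReal.coe_ne_top (m := 2 - 2 * ρ)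
      (by linarith) hDt hbrt
  obtain ⟨Q, hQm, hQ⟩ := PressureSlaving.exists_breatherProfile_of_shiftInvariant (S := 0) hptm hinv
  set p' : ℝ → EuclideanSpace ℝ (Fin 3) → ℝ := fun τ y =>
    if τ < 0 then Real.exp (c * τ) ^ 2 * Q (Real.exp (-(c * τ)) • y) else pt τ y with hp'
  have hP'm : AEStronglyMeasurable (uncurry p') (volume.restrict (Iio (0 : ℝ) ×ˢ (univ : Set (EuclideanSpace ℝ (Fin 3))))) := by
    have hanz : Measurable fun z : ℝ × EuclideanSpace ℝ (Fin 3) => Real.exp (c * z.1) ^ 2 * Q (Real.exp (-(c * z.1)) • z.2) :=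
      ((Real.measurable_exp.comp (measurable_fst.const_mul c)).pow_const 2).mul
        (hQm.comp ((Real.measurable_exp.comp (measurable_fst.const_mul c).neg).smul measurable_snd))
    refine (hanz.aestronglyMeasurable.congr ?_)
    filter_upwards [ae_restrict_mem (measurableSet_Iio.prod MeasurableSet.univ)] with z hz
    have hz1 : z.1 < 0 := hz.1
    show Real.exp (c * z.1) ^ 2 * Q (Real.exp (-(c * z.1)) • z.2) = p' z.1 z.2
    simp only [hp', if_pos hz1]
  have hslice : ∀ᵐ τ ∂(volume.restrict (Iio (0 : ℝ))), p' τ =ᵐ[volume] pt τ := by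
    filter_upwards [hQ, ae_restrict_mem measurableSet_Iio] with τ hτ hτ0
    filter_upwards [hτ] with y hy
    have hτ0' : τ < 0 := hτ0
    simp only [hp', if_pos hτ0']
    exact hy.symm
  have hpp : uncurry p' =ᵐ[volume.restrict (Iio (0 : ℝ) ×ˢ (univ : Set (EuclideanSpace ℝ (Fin 3))))] uncurry pt :=
    PressureSwap.ae_eq_slab_of_ae_ae_eq_slice hptm hP'm hslice
  have hsw' : IsSuitableWeakSolutionOn (slab (EuclideanSpace ℝ (Fin 3)) (Iio 0) isOpen_Iio) 0 0 ut p' :=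
    PressureSwap.isSuitableWeakSolutionOn_slab_congr_pressure_ae hswt hpp
  have hgauge' : ∀ a : ℝ, 1 ≤ a →
      ENNReal.ofReal (a ^ (2 * ρ)) * cknA a (0 : ℝ × EuclideanSpace ℝ (Fin 3)) ut +
          ENNReal.ofReal (a ^ ρ) * cknE a (0 : ℝ × EuclideanSpace ℝ (Fin 3)) Ht +
        ENNReal.ofReal (a ^ (2 * ρ)) * cknD a (0 : ℝ × EuclideanSpace ℝ (Fin 3)) p' ≤ (c₁ : ℝ≥0∞) := by
    intro a ha
    rw [PressureSwap.cknD_congr_pressure hpp a]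
    exact hgauget a ha
  have hp'x : ∀ τ : ℝ, τ < 0 → ∀ y, p' τ y = Real.exp (c * τ) ^ 2 * Q (Real.exp (-(c * τ)) • y) := by
    intro τ hτ y; simp only [hp', if_pos hτ]
  -- ### the translated profile vanishes, hence `V = 0` a.e.
  have hVt0 : Vt =ᵐ[volume] 0 :=
    profile_ae_eq_zero_of_largeGauge_of_contractingBreather_pressure hρ hρh hsw' hHt' hgauge' hc hQm hbrt hp'x
  have hV0 : V =ᵐ[volume] 0 := by
    have hd : Real.exp (c * T₁) ≠ 0 := (Real.exp_pos _).ne'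
    have ht := (quasiMeasurePreserving_smul hd).ae_eq_comp hVt0
    filter_upwards [ht] with z hz
    simp only [comp_apply, Pi.zero_apply, hVt, smul_smul, ← Real.exp_add, neg_add_cancel, Real.exp_zero, one_smul,
      smul_eq_zero] at hz
    rcases hz with h | h
    · exact absurd h (Real.exp_pos _).ne'
    · exact h
  -- ### every slice below `T₁` has zero energy; the energy-quiescent past closes the slab
  have hslice0 : ∀ τ : ℝ, τ < T₁ → ∫⁻ x, ‖u τ x‖ₑ ^ 2 = 0 := by
    intro τ hτ
    have hd : Real.exp (-(c * τ)) ≠ 0 := (Real.exp_pos _).ne'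
    have ht := (quasiMeasurePreserving_smul hd).ae_eq_comp hV0
    have hae : (fun x => ‖u τ x‖ₑ ^ 2) =ᵐ[volume] fun _ => 0 := by
      filter_upwards [ht] with y hy
      simp only [comp_apply, Pi.zero_apply] at hy
      rw [hbr τ hτ y, hy, smul_zero]
      simp
    rw [lintegral_congr_ae hae, lintegral_zero]
  exact PastSymmetric.ae_eq_zero_of_gauge_of_pastSlicesZero hρ.le hsw hH hgauge (T₁ := T₁)
    ((ae_restrict_iff' measurableSet_Iio).2 (ae_of_all _ fun τ hτ => hslice0 τ hτ))

/-- **WEAK BREATHER RIGIDITY, PAST FORM — every log-time breather on a past sub-slab is trivial.**  Crux hypotheses (`0 < ρ ≤ ½`) and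
`u(τ, y) = e^{cτ} V(e^{−cτ} y)` for all `τ < T₁` (`T₁ ≤ 0`) with `c ≠ 0`, ANY profile, nothing assumed on `[T₁, 0)` ⇒ `u = 0` a.e. on the slab
(`c < 0`: `PastShape.ae_eq_zero_of_gauge_of_pastExpandingBreather`; `c > 0`: `ae_eq_zero_of_gauge_of_pastContractingBreather`).  With this the
`IsTameBreather` stratum needs no clause: filler for `∃ T₁ c V, T₁ ≤ 0 ∧ c ≠ 0 ∧ ∀ τ < T₁, ∀ y, u τ y = e^{cτ} • V (e^{−cτ} • y)`. [folklore] -/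
theorem ae_eq_zero_of_gauge_of_pastBreather {ρ : ℝ} (hρ : 0 < ρ) (hρh : ρ ≤ 1 / 2) {c₀ : ℝ≥0}
    (hsw : IsSuitableWeakSolutionOn (slab (EuclideanSpace ℝ (Fin 3)) (Iio 0) isOpen_Iio) 0 0 u p)
    (hH : HasWeakSpatialGradientOn (slab (EuclideanSpace ℝ (Fin 3)) (Iio 0) isOpen_Iio) u H)
    (hgauge : ∀ a : ℝ, 0 < a →
      ENNReal.ofReal (a ^ (2 * ρ)) * cknA a (0 : ℝ × EuclideanSpace ℝ (Fin 3)) u +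
          ENNReal.ofReal (a ^ ρ) * cknE a (0 : ℝ × EuclideanSpace ℝ (Fin 3)) H +
        ENNReal.ofReal (a ^ (2 * ρ)) * cknD a (0 : ℝ × EuclideanSpace ℝ (Fin 3)) p ≤ (c₀ : ℝ≥0∞))
    {T₁ : ℝ} (hT₁ : T₁ ≤ 0) {c : ℝ} (hc : c ≠ 0) {V : EuclideanSpace ℝ (Fin 3) → EuclideanSpace ℝ (Fin 3)}
    (hbr : ∀ τ : ℝ, τ < T₁ → ∀ y, u τ y = Real.exp (c * τ) • V (Real.exp (-(c * τ)) • y)) :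
    uncurry u =ᵐ[volume.restrict (Iio (0 : ℝ) ×ˢ (univ : Set (EuclideanSpace ℝ (Fin 3))))] 0 := by
  rcases lt_or_gt_of_ne hc with hneg | hpos
  · exact PastShape.ae_eq_zero_of_gauge_of_pastExpandingBreather hρ hρh hsw hH hgauge hT₁ hneg hbr
  · exact ae_eq_zero_of_gauge_of_pastContractingBreather hρ hρh hsw hH hgauge hT₁ hpos hbr

end BreatherWeak

end Summit.NavierStokesRegularity.NavierStokesRegularity.Theorems.PowerGaugeEulerLiouville

end
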